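import Literature.AlgebraicGeometry.Resolution.NearPointsCurveCentre
import Mathlib.Algebra.Polynomial.Div
import HarnessLib

/-!
# A near point over a curve centre is unique on its chart and rational over `x` (CoP1, Lemma 4.3 (4))

Topic: `Literature/AlgebraicGeometry/Resolution`. [CoP1] = Cossart–Piltant, J. Algebra 320
(2008) 1051–1082, Lemma 4.3 (4), p. 8: "If `τ(x) = 1`, `Y` is a curve and `x′ ∈ q⁻¹(x)` is
near `x`, then `x′` is uniquely determined and rational over `x`." By `NearPointsChart.lean`
a near point `𝔴` of the chart `B_j` over the closed point has `ρ(𝔴) = (T_l − a)` on the fibre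
line `q⁻¹(x) ≅ ℙ¹_{k(x)}`, with `a ∈ k(x)` pinned down by any non-zero initial form
`F̄ = c_F (Y_l − a Y_j)^μ` of `J` (and `cl_μ J_x ≠ 0` as `ord_x J = μ`). PROVED:

* `MvPolynomial.sub_C_eval_mem_span_X_sub_C` — `g − g(a) ∈ (T − a)` in one variable;
  `eq_of_C_mul_X_sub_C_mul_X_pow_eq` — `c₁ (Y_l − a₁ Y_j)^μ = c₂ (Y_l − a₂ Y_j)^μ`, `c₁ ≠ 0`,
  `μ ≥ 1` force `a₁ = a₂`;
* `eq_of_near_of_near` — **uniqueness on the chart: two near primes `𝔴₁, 𝔴₂ ⊇ 𝔪 B_j` (near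
  for one form `F` with `F̄ ≠ 0`) coincide;**
* `quotient_mk_comp_chartBase_surjective_of_near`, `isMaximal_of_near` — **rationality: for a
  near prime `𝔴`, `R → B_j/𝔴` is onto, so `B_j/𝔴 = R/𝔪 = k(x)` and `𝔴` is a closed point of
  the fibre line;**
* `surjective_residue_comp_of_surjective_quotient_comp` — ring lemma: `R → B/𝔴` onto, `𝔴`
  maximal ⇒ `R → k(B_𝔴)` onto; `algebraMap_eval₂Hom_mem_pow_of_isNear` — nearness read
  on the chart presentation of `𝒪_{X′,x′}`;
* `IsBlowup.residue_comp_stalkMap_surjective_of_isNear` — **scheme level: at a near point `x′`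
  over a point `x` where the centre is cut out by two regular parameters, the residue field
  extension `k(x) → k(x′)` is trivial (every element of `k(x′)` is the residue of a function
  from `𝒪_{X,x}`).**

(Uniqueness of the near point as a point of `X′` additionally needs the injectivity of the chart
presentations of `BlowupStalkCharts.lean` and is not treated here.)

## Sources

* V. Cossart, O. Piltant, J. Algebra 320 (2008) 1051–1082, Lemma 4.3 (4), p. 8.
  [CossartPiltant2008]
-/

noncomputable section

open CategoryTheory CategoryTheory.Limits AlgebraicGeometry TopologicalSpace IsLocalRing MvPolynomial

namespace Literature.AlgebraicGeometry.Resolution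

universe u

open Scheme.IdealSheafData

/-! ## Polynomial lemmas -/

/-- In one variable, `g − g(a) ∈ (T − a)`. [folklore] -/
theorem MvPolynomial.sub_C_eval_mem_span_X_sub_C {k : Type*} [CommRing k] {σ : Type*}
    [Unique σ] (g : MvPolynomial σ k) (a : k) :
    g - C (eval (fun _ => a) g) ∈ Ideal.span {(X default - C a : MvPolynomial σ k)} := by
  let e := MvPolynomial.uniqueAlgEquiv k σ
  obtain ⟨q, hq⟩ := Polynomial.X_sub_C_dvd_sub_C_eval (p := e g) (a := a)
  have h1 : (e g).eval a = eval (fun _ => a) g := by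
    rw [← Polynomial.eval₂_id, eval₂_uniqueAlgEquiv (a := fun _ => a), MvPolynomial.eval₂_id]
  have heX : e.symm Polynomial.X = X default := by
    change Polynomial.eval₂ MvPolynomial.C (X default) Polynomial.X = _
    rw [Polynomial.eval₂_X]
  have heC : ∀ b : k, e.symm (Polynomial.C b) = C b := fun b => by
    change Polynomial.eval₂ MvPolynomial.C (X default) (Polynomial.C b) = _
    rw [Polynomial.eval₂_C]
  rw [Ideal.mem_span_singleton]
  refine ⟨e.symm q, ?_⟩
  apply e.injective
  rw [map_mul, e.apply_symm_apply, map_sub, map_sub, ← heX, e.apply_symm_apply, ← heC a,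
    e.apply_symm_apply, ← heC, e.apply_symm_apply, ← h1]
  exact hq

/-- `c₁ (Y_l − a₁ Y_j)^μ = c₂ (Y_l − a₂ Y_j)^μ` with `c₁ ≠ 0`, `μ ≥ 1` (over a domain) forces
`c₁ = c₂` and `a₁ = a₂` (evaluate at `(Y_l, Y_j) = (1, 0)` and `(a₁, 1)`). [folklore] -/
theorem eq_of_C_mul_X_sub_C_mul_X_pow_eq {k : Type*} [CommRing k] [IsDomain k] {j l : Fin 2}
    (hl : l ≠ j) {a₁ a₂ c₁ c₂ : k} {μ : ℕ} (hμ : 1 ≤ μ) (hc₁ : c₁ ≠ 0)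
    (h : (C c₁ * (X l - C a₁ * X j) ^ μ : MvPolynomial (Fin 2) k) =
      C c₂ * (X l - C a₂ * X j) ^ μ) :
    c₁ = c₂ ∧ a₁ = a₂ := by
  have hev : ∀ (v : Fin 2 → k) (a c : k),
      eval v (C c * (X l - C a * X j) ^ μ : MvPolynomial (Fin 2) k) = c * (v l - a * v j) ^ μ := by
    intro v a c
    simp only [map_mul, map_pow, map_sub, eval_C, eval_X]
  have h1 := congrArg (eval (Function.update (fun _ => (0 : k)) l 1)) h
  rw [hev, hev, Function.update_self, Function.update_of_ne (Ne.symm hl), mul_zero, mul_zero,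
    sub_zero, one_pow, mul_one, mul_one] at h1
  refine ⟨h1, ?_⟩
  have h2 := congrArg (eval (Function.update (fun _ => a₁) j 1)) h
  rw [hev, hev, Function.update_self, Function.update_of_ne hl, mul_one, mul_one, sub_self,
    zero_pow (by omega), mul_zero, ← h1] at h2
  have h3 : (a₁ - a₂) ^ μ = 0 := by
    rcases mul_eq_zero.mp h2.symm with h | h
    · exact absurd h hc₁
    · exact h
  exact sub_eq_zero.mp (pow_eq_zero_iff (by omega) |>.mp h3)

/-! ## The chart: uniqueness and rationality of near points -/

section Chart

variable {R : Type u} [CommRing R] [IsLocalRing R] (c : Fin 2 → R) (j : Fin 2) {l : Fin 2}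
  (hl : l ≠ j)

include hl in
/-- **[CoP1] Lemma 4.3 (4), uniqueness on a chart.** In the chart `B_j` of the blowing up of the
local ring `R` along the quasi-regular `c = (c_1, c_2) ⊆ 𝔪`, two primes `𝔴₁, 𝔴₂ ⊇ 𝔪 B_j` at
which one form `F` of degree `μ ≥ 1` with `F̄ ≠ 0` is near (`F(e) ∈ 𝔴ᵢ^μ (B_j)_{𝔴ᵢ}`) coincide:
both are `ρ⁻¹(T_l − a)` with `a` read off from `F̄ = c_F (Y_l − a Y_j)^μ`.
[cite: CossartPiltant2008, Lemma 4.3 (4)] -/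
theorem eq_of_near_of_near (hcq : IsQuasiRegular c) (hcm : ∀ i, c i ∈ maximalIdeal R)
    {F : MvPolynomial (Fin 2) R} {μ : ℕ} (hμ : 1 ≤ μ) (hF : F.IsHomogeneous μ)
    (hF0 : MvPolynomial.map (residue R) F ≠ 0)
    (𝔴₁ 𝔴₂ : Ideal (chartRing c j)) [𝔴₁.IsPrime] [𝔴₂.IsPrime]
    (h𝔴₁ : (maximalIdeal R).map (chartBase c j) ≤ 𝔴₁)
    (h𝔴₂ : (maximalIdeal R).map (chartBase c j) ≤ 𝔴₂)
    (hnear₁ : (algebraMap (chartRing c j) (Localization.AtPrime 𝔴₁) :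
        chartRing c j →+* Localization.AtPrime 𝔴₁)
        (MvPolynomial.eval₂Hom (chartBase c j) (fun i => chartGen c j i) F) ∈
      maximalIdeal (Localization.AtPrime 𝔴₁) ^ μ)
    (hnear₂ : (algebraMap (chartRing c j) (Localization.AtPrime 𝔴₂) :
        chartRing c j →+* Localization.AtPrime 𝔴₂)
        (MvPolynomial.eval₂Hom (chartBase c j) (fun i => chartGen c j i) F) ∈
      maximalIdeal (Localization.AtPrime 𝔴₂) ^ μ) :
    𝔴₁ = 𝔴₂ := by
  classical
  obtain ⟨ρ, hρsurj, hρker, hρF⟩ :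
      ∃ ρ : chartRing c j →+* MvPolynomial {i : Fin 2 // i ≠ j} (ResidueField R),
        Function.Surjective ρ ∧ RingHom.ker ρ = (maximalIdeal R).map (chartBase c j) ∧
        ∀ F : MvPolynomial (Fin 2) R,
          ρ (MvPolynomial.eval₂Hom (chartBase c j) (fun i => chartGen c j i) F) =
            MvPolynomial.map (residue R) (dehomogenize j F) :=
    exists_chartResidueMap c j hcq hcm
  obtain ⟨a₁, c₁, hq₁, hF₁⟩ := exists_map_residue_eq_C_mul_X_sub_C_mul_X_pow c j hl hρsurj hρker
    hρF hμ hF hF0 𝔴₁ h𝔴₁ hnear₁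
  obtain ⟨a₂, c₂, hq₂, hF₂⟩ := exists_map_residue_eq_C_mul_X_sub_C_mul_X_pow c j hl hρsurj hρker
    hρF hμ hF hF0 𝔴₂ h𝔴₂ hnear₂
  have hc₁ : c₁ ≠ 0 := by
    rintro rfl
    exact hF0 (by rw [hF₁, C_0, zero_mul])
  obtain ⟨-, ha⟩ := eq_of_C_mul_X_sub_C_mul_X_pow_eq hl hμ hc₁ (hF₁.symm.trans hF₂)
  have hcomap : ∀ (𝔴 : Ideal (chartRing c j)) [𝔴.IsPrime],
      (maximalIdeal R).map (chartBase c j) ≤ 𝔴 → 𝔴 = (𝔴.map ρ).comap ρ := by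
    intro 𝔴 _ h𝔴
    rw [Ideal.comap_map_of_surjective ρ hρsurj, ← RingHom.ker_eq_comap_bot,
      sup_eq_left.mpr (hρker.trans_le h𝔴)]
  rw [hcomap 𝔴₁ h𝔴₁, hcomap 𝔴₂ h𝔴₂, hq₁, hq₂, ha]

include hl in
/-- **[CoP1] Lemma 4.3 (4), rationality on a chart: `R → B_j/𝔴` is onto at a near prime.**
With `ρ(𝔴) = (T_l − a)`: every `b ∈ B_j` is congruent modulo `𝔴` to the constant `ρ(b)(a)`,
which lifts to `R`. [cite: CossartPiltant2008, Lemma 4.3 (4)] -/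
theorem quotient_mk_comp_chartBase_surjective_of_near (hcq : IsQuasiRegular c)
    (hcm : ∀ i, c i ∈ maximalIdeal R) {F : MvPolynomial (Fin 2) R} {μ : ℕ} (hμ : 1 ≤ μ)
    (hF : F.IsHomogeneous μ) (hF0 : MvPolynomial.map (residue R) F ≠ 0)
    (𝔴 : Ideal (chartRing c j)) [𝔴.IsPrime] (h𝔴 : (maximalIdeal R).map (chartBase c j) ≤ 𝔴)
    (hnear : (algebraMap (chartRing c j) (Localization.AtPrime 𝔴) :
        chartRing c j →+* Localization.AtPrime 𝔴)
        (MvPolynomial.eval₂Hom (chartBase c j) (fun i => chartGen c j i) F) ∈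
      maximalIdeal (Localization.AtPrime 𝔴) ^ μ) :
    Function.Surjective ((Ideal.Quotient.mk 𝔴).comp (chartBase c j)) := by
  classical
  haveI : Unique {i : Fin 2 // i ≠ j} := (finSuccAboveEquiv j).symm.unique
  obtain ⟨ρ, hρsurj, hρker, hρF⟩ :
      ∃ ρ : chartRing c j →+* MvPolynomial {i : Fin 2 // i ≠ j} (ResidueField R),
        Function.Surjective ρ ∧ RingHom.ker ρ = (maximalIdeal R).map (chartBase c j) ∧
        ∀ F : MvPolynomial (Fin 2) R,
          ρ (MvPolynomial.eval₂Hom (chartBase c j) (fun i => chartGen c j i) F) =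
            MvPolynomial.map (residue R) (dehomogenize j F) :=
    exists_chartResidueMap c j hcq hcm
  obtain ⟨a, c₀, hq, -⟩ := exists_map_residue_eq_C_mul_X_sub_C_mul_X_pow c j hl hρsurj hρker
    hρF hμ hF hF0 𝔴 h𝔴 hnear
  have hdef : (⟨l, hl⟩ : {i : Fin 2 // i ≠ j}) = default := Subsingleton.elim _ _
  rw [hdef] at hq
  have hcomap : 𝔴 = (𝔴.map ρ).comap ρ := by
    rw [Ideal.comap_map_of_surjective ρ hρsurj, ← RingHom.ker_eq_comap_bot,
      sup_eq_left.mpr (hρker.trans_le h𝔴)]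
  have hρC : ∀ r : R, ρ (chartBase c j r) = C (residue R r) := fun r => by
    have h := hρF (C r)
    rwa [MvPolynomial.eval₂Hom_C, MvPolynomial.algHom_C, MvPolynomial.algebraMap_eq,
      MvPolynomial.map_C] at h
  intro y
  obtain ⟨b, rfl⟩ := Ideal.Quotient.mk_surjective y
  obtain ⟨r, hr⟩ := Ideal.Quotient.mk_surjective (I := maximalIdeal R) (eval (fun _ => a) (ρ b))
  refine ⟨r, ?_⟩
  rw [RingHom.comp_apply, Ideal.Quotient.eq, hcomap, Ideal.mem_comap, map_sub, hρC, hq]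
  have h := MvPolynomial.sub_C_eval_mem_span_X_sub_C (ρ b) a
  have hres : (C (residue R r) : MvPolynomial {i : Fin 2 // i ≠ j} (ResidueField R)) =
      C (eval (fun _ => a) (ρ b)) := by
    rw [← hr]
    rfl
  rw [hres, ← neg_sub (ρ b) (C (eval (fun _ => a) (ρ b)))]
  exact neg_mem h

include hl in
/-- Hence **a near prime over the closed point is a maximal ideal with residue field `R/𝔪`**
(a closed, `k(x)`-rational point of the fibre line). [cite: CossartPiltant2008, Lemma 4.3 (4)] -/
theorem isMaximal_of_near (hcq : IsQuasiRegular c) (hcm : ∀ i, c i ∈ maximalIdeal R)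
    {F : MvPolynomial (Fin 2) R} {μ : ℕ} (hμ : 1 ≤ μ) (hF : F.IsHomogeneous μ)
    (hF0 : MvPolynomial.map (residue R) F ≠ 0)
    (𝔴 : Ideal (chartRing c j)) [h𝔴p : 𝔴.IsPrime] (h𝔴 : (maximalIdeal R).map (chartBase c j) ≤ 𝔴)
    (hnear : (algebraMap (chartRing c j) (Localization.AtPrime 𝔴) :
        chartRing c j →+* Localization.AtPrime 𝔴)
        (MvPolynomial.eval₂Hom (chartBase c j) (fun i => chartGen c j i) F) ∈
      maximalIdeal (Localization.AtPrime 𝔴) ^ μ) :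
    𝔴.IsMaximal := by
  have hsurj := quotient_mk_comp_chartBase_surjective_of_near c j hl hcq hcm hμ hF hF0 𝔴 h𝔴 hnear
  set f := (Ideal.Quotient.mk 𝔴).comp (chartBase c j) with hf
  haveI : Nontrivial (chartRing c j ⧸ 𝔴) := Ideal.Quotient.nontrivial_iff.mpr h𝔴p.ne_top
  have hker : RingHom.ker f = maximalIdeal R := by
    refine ((IsLocalRing.maximalIdeal.isMaximal R).eq_of_le (RingHom.ker_ne_top f) ?_).symm
    intro r hr
    rw [RingHom.mem_ker, hf, RingHom.comp_apply, Ideal.Quotient.eq_zero_iff_mem]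
    exact h𝔴 (Ideal.mem_map_of_mem _ hr)
  have e : R ⧸ RingHom.ker f ≃+* chartRing c j ⧸ 𝔴 := RingHom.quotientKerEquivOfSurjective hsurj
  have hfield : IsField (chartRing c j ⧸ 𝔴) := by
    have h1 : IsField (R ⧸ RingHom.ker f) := by
      rw [hker]
      exact (Ideal.Quotient.maximal_ideal_iff_isField_quotient _).mp inferInstance
    exact MulEquiv.isField h1 e.symm.toMulEquiv
  exact Ideal.Quotient.maximal_of_isField _ hfield

end Chart

/-! ## From `B_j/𝔴 = k(x)` to the residue field of the local ring -/

/-- If `R → B/𝔴` is onto for a maximal ideal `𝔴` of `B`, then so is `R → B_𝔴 → k(B_𝔴)` for any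
localization `S = B_𝔴` of `B` at `𝔴`: an element `b/t` of `S` has residue `θ(b) θ(t')` where
`t t' ≡ 1 (mod 𝔴)`, and `b t'` is congruent to an element of `R`. [folklore] -/
theorem surjective_residue_comp_of_surjective_quotient_comp {R B S : Type*} [CommRing R]
    [CommRing B] [CommRing S] [IsLocalRing S] (φ : R →+* B) (𝔴 : Ideal B) [h𝔴 : 𝔴.IsMaximal]
    [Algebra B S] [IsLocalization.AtPrime S 𝔴]
    (hsurj : Function.Surjective ((Ideal.Quotient.mk 𝔴).comp φ)) :
    Function.Surjective ((IsLocalRing.residue S).comp ((algebraMap B S).comp φ)) := by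
  obtain ⟨θ, hθ⟩ : ∃ θ : B →+* ResidueField S, θ = (IsLocalRing.residue S).comp (algebraMap B S) :=
    ⟨_, rfl⟩
  have hθ𝔴 : ∀ w ∈ 𝔴, θ w = 0 := fun w hw => by
    rw [hθ, RingHom.comp_apply, IsLocalRing.residue_eq_zero_iff]
    exact (IsLocalization.AtPrime.to_map_mem_maximal_iff S 𝔴 w).mpr hw
  have hθeq : ∀ v w : B, v - w ∈ 𝔴 → θ v = θ w := fun v w h => by
    rw [← sub_eq_zero, ← map_sub]
    exact hθ𝔴 _ h
  intro y
  obtain ⟨s, rfl⟩ := IsLocalRing.residue_surjective y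
  obtain ⟨⟨b, t⟩, rfl⟩ := IsLocalization.mk'_surjective 𝔴.primeCompl s
  -- an inverse `t'` of `t` modulo the maximal ideal `𝔴`
  obtain ⟨t', ht'⟩ : ∃ t' : B, (t : B) * t' - 1 ∈ 𝔴 := by
    letI := Ideal.Quotient.field 𝔴
    have ht0 : Ideal.Quotient.mk 𝔴 (t : B) ≠ 0 := fun h =>
      t.2 (Ideal.Quotient.eq_zero_iff_mem.mp h)
    obtain ⟨t', ht'⟩ := Ideal.Quotient.mk_surjective ((Ideal.Quotient.mk 𝔴 (t : B))⁻¹)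
    refine ⟨t', Ideal.Quotient.eq.mp ?_⟩
    rw [map_mul, ht', mul_inv_cancel₀ ht0, map_one]
  obtain ⟨r, hr⟩ := hsurj (Ideal.Quotient.mk 𝔴 (b * t'))
  refine ⟨r, ?_⟩
  have h1 : θ (φ r) = θ (b * t') := hθeq _ _ (Ideal.Quotient.eq.mp hr)
  have h2 : θ t * θ t' = 1 := by
    rw [← map_mul, ← map_one θ]
    exact hθeq _ _ ht'
  have h3 : IsLocalRing.residue S (IsLocalization.mk' S b t) * θ t = θ b := by
    rw [hθ, RingHom.comp_apply, RingHom.comp_apply, ← map_mul, IsLocalization.mk'_spec]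
  calc ((IsLocalRing.residue S).comp ((algebraMap B S).comp φ)) r = θ (φ r) := by rw [hθ]; rfl
    _ = θ b * θ t' := by rw [h1, map_mul]
    _ = IsLocalRing.residue S (IsLocalization.mk' S b t) * (θ t * θ t') := by rw [← h3, mul_assoc]
    _ = IsLocalRing.residue S (IsLocalization.mk' S b t) := by rw [h2, mul_one]

/-! ## Schemes: a near point over a curve centre is rational over `x` -/

section Scheme

variable {X X' : Scheme.{u}} {π : X' ⟶ X}

set_option maxHeartbeats 400000 in
/-- **Nearness read on a chart.** In the chart presentation `𝒪_{X′,x′} = (B_j)_𝔴`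
(`IsBlowup.exists_reesChart_stalk`) of a point `x′` of the blowing up along the regular centre
`Y ⊆ {ord = μ}` with `𝓘_{Y,x} = (c)` at `x = π x′`: if `x′` is near, then every form `F` of
degree `μ` with `F(c) ∈ J_x` has `F(e) ∈ 𝔴^μ (B_j)_𝔴` (`χ(F(e)) ∈ J′_{x′} ⊆ 𝔪_{x′}^μ`).
[cite: CossartPiltant2008, proof of Prop. 4.2, (11)] -/
theorem algebraMap_eval₂Hom_mem_pow_of_isNear [IsLocallyNoetherian X]
    [IsLocallyNoetherian X'] {Y : Closeds X} {J : X.IdealSheafData} {μ : ℕ} {x' : X'}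
    {k : ℕ} {c : Fin k → X.presheaf.stalk (π x')}
    (hcY : Ideal.span (Set.range c) = stalkIdeal (vanishingIdeal Y) (π x')) (j : Fin k)
    (𝔴 : PrimeSpectrum (chartRing c j)) (χ : chartRing c j →+* X'.presheaf.stalk x')
    (hχ : ∀ a, χ (chartBase c j a) = (π.stalkMap x').hom a)
    (hloc : @IsLocalization.AtPrime _ _ (X'.presheaf.stalk x') _ χ.toAlgebra 𝔴.asIdeal _)
    (hnear : IsNear π (vanishingIdeal Y) J μ x') {F : MvPolynomial (Fin k) (X.presheaf.stalk (π x'))}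
    (hF : F.IsHomogeneous μ) (hFJ : MvPolynomial.eval c F ∈ stalkIdeal J (π x')) :
    (algebraMap (chartRing c j) (Localization.AtPrime 𝔴.asIdeal) :
        chartRing c j →+* Localization.AtPrime 𝔴.asIdeal)
        (MvPolynomial.eval₂Hom (chartBase c j) (fun i => chartGen c j i) F) ∈
      maximalIdeal (Localization.AtPrime 𝔴.asIdeal) ^ μ := by
  classical
  letI := χ.toAlgebra
  haveI : IsLocalization.AtPrime (X'.presheaf.stalk x') 𝔴.asIdeal := hloc
  have hff' := reesChartBase_eval_eq_pow_mul_eval₂ c j hF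
  have hu : ∀ i, (π.stalkMap x').hom (c i) = (π.stalkMap x').hom (c j) * χ (chartGen c j i) :=
    fun i => by rw [← hχ, ← hχ, ← map_mul, ← reesChartBase_apply_eq_mul_chartGen c j i]
  have hCmap : (stalkIdeal (vanishingIdeal Y) (π x')).map (π.stalkMap x').hom =
      Ideal.span {χ (chartBase c j (c j))} := by
    rw [← hcY, Ideal.map_span_range_eq_span_singleton _ c j _ hu, ← hχ]
  have hmem : χ (MvPolynomial.eval₂Hom (chartBase c j) (fun i => chartGen c j i) F) ∈
      stalkIdeal (controlledTransform π (vanishingIdeal Y) J μ) x' := by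
    rw [controlledTransform, stalkIdeal_colon, stalkIdeal_pow, stalkIdeal_comap_eq_map_stalkMap,
      stalkIdeal_comap_eq_map_stalkMap, hCmap]
    exact map_mem_colon_of_eq_pow_mul (chartBase c j) χ (π.stalkMap x').hom hχ hff' hFJ
  have hle : stalkIdeal (controlledTransform π (vanishingIdeal Y) J μ) x' ≤
      maximalIdeal (X'.presheaf.stalk x') ^ μ :=
    (le_idealOrder_iff _ x' μ).mp (isNear_iff.mp hnear).ge
  by_contra hnot
  exact algebraMap_not_mem_maximalIdeal_pow_of_isLocalization 𝔴.asIdeal hnot (hle hmem)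

set_option maxHeartbeats 400000 in
/-- **[CoP1] Lemma 4.3 (4): a near point over a curve centre is rational over `x`.** Let `π` be
the blowing up of the regular locally Noetherian `X` along a regular centre `Y ⊆ {ord = μ}`,
`μ ≥ 1`, whose ideal at `x = π x′` is generated by two members `c` of a regular system of
parameters of `𝒪_{X,x}`. If `x′` is near, then `k(x) → k(x′)` is onto: every element of the
residue field of `𝒪_{X′,x′}` is the residue of `π^♯(r)` for some `r ∈ 𝒪_{X,x}` (on the chart,
`𝒪_{X′,x′} = (B_j)_𝔴` with `B_j/𝔴 = k(x)` by `quotient_mk_comp_chartBase_surjective_of_near`).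
[cite: CossartPiltant2008, Lemma 4.3 (4)] -/
theorem IsBlowup.residue_comp_stalkMap_surjective_of_isNear [IsLocallyNoetherian X]
    [IsLocallyNoetherian X'] (hX : Scheme.IsRegular X) {Y : Closeds X}
    (hreg : Scheme.IsRegular (vanishingIdeal Y).subscheme) (hπ : IsBlowup π (vanishingIdeal Y))
    {J : X.IdealSheafData} {μ : ℕ} (hμ : 1 ≤ μ) (hY : ∀ y ∈ (Y : Set X), idealOrder J y = μ)
    {x' : X'} [IsRegularLocalRing (X.presheaf.stalk (π x'))]
    {c : Fin 2 → X.presheaf.stalk (π x')} (hcr : IsRsopPart c)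
    (hcY : Ideal.span (Set.range c) = stalkIdeal (vanishingIdeal Y) (π x'))
    (hnear : IsNear π (vanishingIdeal Y) J μ x') :
    Function.Surjective
      ((IsLocalRing.residue (X'.presheaf.stalk x')).comp (π.stalkMap x').hom) := by
  classical
  have hx : π x' ∈ (Y : Set X) := by
    rw [← coe_support_vanishingIdeal, SetLike.mem_coe, mem_support_iff_stalkIdeal_le, ← hcY]
    exact hcr.span_range_le_maximalIdeal
  have hcm : ∀ i, c i ∈ maximalIdeal _ := hcr.mem_maximalIdeal
  have hcq : IsQuasiRegular c := by
    obtain ⟨e, z, hd, hz, hzc⟩ := hcr.exists_rsop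
    have h := isQuasiRegular_rsop_comp hd z hz (Fin.castAdd e) (Fin.castAdd_injective 2 e)
    rwa [show z ∘ Fin.castAdd e = c from funext hzc] at h
  -- the chart presentation `𝒪_{X',x'} = (B_j)_𝔴`, `𝔴 ⊇ 𝔪 B_j`
  obtain ⟨j, 𝔴, χ, hχ, hloc, h𝔴⟩ := hπ.exists_reesChart_stalk x' c hcY
  have h𝔴' : (maximalIdeal _).map (chartBase c j) ≤ 𝔴.asIdeal := by
    rw [← h𝔴]
    exact Ideal.map_comap_le
  obtain ⟨l, hl⟩ : ∃ l : Fin 2, l ≠ j := ⟨j + 1, by fin_cases j <;> decide⟩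
  -- a form `F` of degree `μ` with `F(c) ∈ J_x` and `F̄ ≠ 0` (`ord_x J = μ`, `J_x ⊆ P^μ`)
  have hJP : stalkIdeal J (π x') ≤ Ideal.span (Set.range c) ^ μ := by
    rw [hcY, ← stalkIdeal_pow]
    exact stalkIdeal_mono (le_vanishingIdeal_pow_of_forall_idealOrder_eq hX hreg hY) _
  have hJnot : ¬ stalkIdeal J (π x') ≤ maximalIdeal _ ^ (μ + 1) := by
    rw [← le_idealOrder_iff, hY (π x') hx]
    exact_mod_cast Nat.not_succ_le_self μ
  obtain ⟨f, hfJ, hf'⟩ := Set.not_subset.mp hJnot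
  obtain ⟨F, hF, hFf⟩ := exists_isHomogeneous_of_mem_span_pow c μ (hJP hfJ)
  have hF0 : MvPolynomial.map (residue _) F ≠ 0 :=
    map_residue_ne_zero_of_eval_not_mem_pow_succ c hcm hF (by rw [hFf]; exact hf')
  have hFJ : MvPolynomial.eval c F ∈ stalkIdeal J (π x') := by
    rw [hFf]
    exact hfJ
  have hnearF := algebraMap_eval₂Hom_mem_pow_of_isNear hcY j 𝔴 χ hχ hloc hnear hF hFJ
  -- `R → B_j/𝔴` is onto, `𝔴` is maximal, hence `R → k(x')` is onto
  have hsurj := quotient_mk_comp_chartBase_surjective_of_near c j hl hcq hcm hμ hF hF0 𝔴.asIdeal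
    h𝔴' hnearF
  haveI h𝔴max : 𝔴.asIdeal.IsMaximal :=
    isMaximal_of_near c j hl hcq hcm hμ hF hF0 𝔴.asIdeal h𝔴' hnearF
  letI := χ.toAlgebra
  haveI : IsLocalization.AtPrime (X'.presheaf.stalk x') 𝔴.asIdeal := hloc
  have key := surjective_residue_comp_of_surjective_quotient_comp (S := X'.presheaf.stalk x')
    (chartBase c j) 𝔴.asIdeal hsurj
  have heq : (IsLocalRing.residue (X'.presheaf.stalk x')).comp (π.stalkMap x').hom =
      (IsLocalRing.residue (X'.presheaf.stalk x')).comp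
        ((algebraMap (chartRing c j) (X'.presheaf.stalk x')).comp (chartBase c j)) := by
    ext a
    rw [RingHom.comp_apply, RingHom.comp_apply, RingHom.comp_apply, ← hχ]
    rfl
  rw [heq]
  exact key

end Scheme

end Literature.AlgebraicGeometry.Resolution

end
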